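import Summits.AtomisticToContinuum.HydrodynamicLimit.Theses.ImplosionDichotomy
import Summits.AtomisticToContinuum.HydrodynamicLimit.Theorems.DenseExcursion.Negative.Untied

/-!
# `PolynomialCompression` without its admissibility tie is TRUE (load-bearing analysis)

Negative knowledge for the crux `ImplosionDichotomy.PolynomialCompression` (stmt-AtomisticToContinuum-12587), from
the standing disprover's `Cruxes/PolynomialCompression/Disproof.lean` §7. `PolynomialCompressionUntied` is the crux
VERBATIM with the `t = 0` law-of-large-numbers tie `∀ Φ, TendstoHydroFieldsAt (localGibbsLaw …) Φ ρ u θ 0` deleted,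
and it HOLDS — the constant state of density `σ⁻¹` (velocity `0`, temperature `1`) is a classical hard-sphere-Euler
solution for every `σ` (all derivatives vanish, whatever the equation of state) and has density `σ^(-κ)` for
`κ = 1`. Since the crux is an `∃`-statement, dropping a constraint on the witness makes it weaker: so the tie is the
ONLY constraint, ANY DISPROOF of the crux (equivalently, by `Negative/Ladder.lean`, any proof of
`DiluteSelfConsistency`) must work through the tie, i.e. through the pinned initial data
(`Negative/AtTimeZero.lean`), and every PROOF must produce genuinely admissible data. The constant-state witness
is the sibling crux's `DenseExcursionUntied.isHardSphereEulerSolution_const` (imported, not re-declared).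
refuter-cdisprove-stmt-AtomisticToContinuum-12587-g3-0.
-/

noncomputable section

namespace Summit.AtomisticToContinuum.HydrodynamicLimit.Theorems

open Set
open Literature.MathematicalPhysics.KineticTheory
open Summit.AtomisticToContinuum.HydrodynamicLimit.Theses.ImplosionDichotomy (PolynomialCompression)

/-- The crux `PolynomialCompression` with the ADMISSIBILITY TIE deleted (all else verbatim). -/
def PolynomialCompressionUntied : Prop :=
  ∃ κ : ℝ, 0 < κ ∧ ∃ (a₀ θ₀ : T3 → ℝ) (u₀ : T3 → V3), Continuous a₀ ∧ Continuous θ₀ ∧ Continuous u₀ ∧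
    (∀ x, 0 < a₀ x) ∧ (∀ x, 0 < θ₀ x) ∧ ∀ σ₀ : ℝ, 0 < σ₀ → ∃ σ : ℝ, 0 < σ ∧ σ < σ₀ ∧
      ∃ (T : ℝ) (ρ θ : ℝ → T3 → ℝ) (u : ℝ → T3 → V3), IsHardSphereEulerSolution σ T ρ u θ ∧
        ∃ t ∈ Ico 0 T, ∃ x, σ ^ (-κ) ≤ ρ t x

/-- The untied statement is weaker than the crux (forget the tie). [folklore] -/
theorem polynomialCompressionUntied_of (h : PolynomialCompression) : PolynomialCompressionUntied := by
  obtain ⟨κ, hκ, a₀, θ₀, u₀, ha, hθ, hu, ha0, hθ0, H⟩ := h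
  refine ⟨κ, hκ, a₀, θ₀, u₀, ha, hθ, hu, ha0, hθ0, fun σ₀ hσ₀ => ?_⟩
  obtain ⟨σ, hσ, hσlt, T, ρ, θ, u, hE, -, hx⟩ := H σ₀ hσ₀
  exact ⟨σ, hσ, hσlt, T, ρ, θ, u, hE, hx⟩

open DenseExcursionUntied in
/-- THE TIE IS THE ONLY CONSTRAINT: without admissibility the crux holds, witnessed at `κ = 1` by the constant
state of density `(σ₀/2)⁻¹` at `σ = σ₀/2` (velocity `0`, temperature `1`, any profiles). [folklore] -/
theorem polynomialCompressionUntied_holds : PolynomialCompressionUntied := by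
  refine ⟨1, one_pos, fun _ => 1, fun _ => 1, fun _ => 0, continuous_const, continuous_const,
    continuous_const, fun _ => one_pos, fun _ => one_pos, fun σ₀ hσ₀ => ?_⟩
  have hσ : 0 < σ₀ / 2 := by positivity
  refine ⟨σ₀ / 2, hσ, by linarith, 1, fun _ _ => (σ₀ / 2)⁻¹, fun _ _ => 1, fun _ _ => 0,
    isHardSphereEulerSolution_const _ 1 0 (inv_pos.2 hσ) one_pos, 0, ⟨le_rfl, one_pos⟩, 0, ?_⟩
  rw [Real.rpow_neg hσ.le, Real.rpow_one]

end Summit.AtomisticToContinuum.HydrodynamicLimit.Theorems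

end
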